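import Mathlib.Analysis.SpecialFunctions.Integrability.Basic
import Mathlib.Analysis.SpecialFunctions.ImproperIntegrals
import Mathlib.MeasureTheory.Integral.Pi
import Literature.NumberTheory.Transcendental.KZSliceFubini
import Literature.NumberTheory.Transcendental.KZProduct
import Literature.NumberTheory.Transcendental.KZDominatedFamily
import Literature.NumberTheory.Transcendental.KZSemialgebraicComplex
import Literature.NumberTheory.Transcendental.KZIntervalPeriodProofs
import Summits.KontsevichZagierPeriods.KontsevichZagierPeriods.Theses.ValuedFieldSpecialisation

/-!
# Route ValuedFieldSpecialisation — elementary divergent products: domain, integrand, envelopes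

Helper for item stmt-KontsevichZagierPeriods-3503 (`ClassLevelExpansionFibreDimOne`), first of
two files on the EXISTENCE of the item's elementary divergent product representations `P`
(dimension `b + d + 2`, coordinates `(s, u, y₁…y_b, w₁…w_d)`, domain `0 < s < 1`, `0 < u`,
`u^q s^p < 1`, `s ≤ y_j ≤ 1`, `w ∈ ρ.domain`, integrand `∏ y_j⁻¹ · ρ.integrand w`). This file:

* Tonelli bookkeeping in `Fin`-coordinates: integrability of separable products along
  `(s, x) ↦ vecCons s x` and `(y, w) ↦ Fin.append y w` (both measure preserving) and over the
  coordinates of `ℝᵇ`;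
* the one-variable integrable envelopes `𝟙_(0,1) s^(−e)`, `𝟙_(0,1] y^(−e)` (`e < 1`) and the
  envelope `𝟙_(0,1] + 𝟙_(1,∞) u^(−γ)` (`γ > 1`) of the padding coordinate;
* the inequalities `u < s^(−p/q)` on the domain and `y⁻¹ ≤ s^(−δ) y^(−(1−δ))` for `s ≤ y`;
* the domain in coordinates is `ℚ`-semialgebraic and equals the item's `∃`-description; the
  integrand is `ℚ`-semialgebraic on it.

The companion file proves integrability and assembles the representation.

Sources: M. Kontsevich, D. Zagier, *Periods* (2001), §1.1; J. Bochnak, M. Coste, M.-F. Roy,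
*Real Algebraic Geometry* (1998), §2.1–2.2. The encoding is this route's. Deliberately NOT here:
the integrability of the elementary products (companion file).
-/

noncomputable section

namespace Summit.KontsevichZagierPeriods.ValuedFieldSpecialisation

open MeasureTheory Set Filter MvPolynomial
open scoped Topology
open Literature.NumberTheory.Transcendental Literature.NumberTheory.Transcendental.KZ
open Literature.ModelTheory.ExponentialFields (IsSemialgebraic isSemialgebraic_setOf_eval_pos
  isSemialgebraic_setOf_eval_eq_zero isSemialgebraic_setOf_eval_lt isSemialgebraic_setOf_eval_le)

/-! ### Integrability of separable products in `Fin`-coordinates -/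

/-- **Tonelli along `vecCons`**: `z ↦ f (z 0) · Θ (tail z)` is integrable on `ℝᵐ⁺¹` when `f` is
integrable on `ℝ` and `Θ` on `ℝᵐ`. [folklore] -/
theorem integrable_cons_mul {m : ℕ} {f : ℝ → ℝ} {Θ : (Fin m → ℝ) → ℝ} (hf : Integrable f)
    (hΘ : Integrable Θ) :
    Integrable (fun z : Fin (m + 1) → ℝ => f (z 0) * Θ (fun i => z i.succ)) := by
  have h := hf.mul_prod hΘ
  refine (measurePreserving_vecCons.integrable_comp_emb measurableEmbedding_vecCons).mp ?_
  convert h using 1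
  ext p
  simp

/-- **Tonelli along `Fin.append`**: `x ↦ Θ₁ (x|_b) · Θ₂ (x|^d)` is integrable on `ℝᵇ⁺ᵈ` when `Θ₁`
is integrable on `ℝᵇ` and `Θ₂` on `ℝᵈ`. [folklore] -/
theorem integrable_append_mul {b d : ℕ} {Θ₁ : (Fin b → ℝ) → ℝ} {Θ₂ : (Fin d → ℝ) → ℝ}
    (h₁ : Integrable Θ₁) (h₂ : Integrable Θ₂) :
    Integrable (fun x : Fin (b + d) → ℝ =>
      Θ₁ (fun j => x (Fin.castAdd d j)) * Θ₂ (fun l => x (Fin.natAdd b l))) := by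
  have h := h₁.mul_prod h₂
  rw [← Measure.volume_eq_prod] at h
  refine ((volume_preserving_appendMeasurableEquiv (n := b) (m := d)).integrable_comp_emb
    (appendMeasurableEquiv b d).measurableEmbedding).mp ?_
  have hfun : ((fun x : Fin (b + d) → ℝ =>
      Θ₁ (fun j => x (Fin.castAdd d j)) * Θ₂ (fun l => x (Fin.natAdd b l))) ∘
        ⇑(appendMeasurableEquiv b d)) = fun z => Θ₁ z.1 * Θ₂ z.2 := by
    funext z
    simp
  rw [hfun]
  exact h

/-- A product of one-variable integrable functions over the coordinates of `ℝᵇ` is integrable.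
[folklore] -/
theorem integrable_pi_prod {b : ℕ} {h : ℝ → ℝ} (hh : Integrable h) :
    Integrable (fun y : Fin b → ℝ => ∏ j, h (y j)) :=
  Integrable.fintype_prod (f := fun _ : Fin b => h) fun _ => hh

/-! ### One-variable integrable envelopes -/

/-- `𝟙_(0,1) · s^(-e)` is integrable for `e < 1`. [folklore] -/
theorem integrable_indicator_Ioo_rpow_neg {e : ℝ} (he : e < 1) :
    Integrable ((Ioo (0 : ℝ) 1).indicator fun s => s ^ (-e)) :=
  (integrable_indicator_iff measurableSet_Ioo).mpr
    ((intervalIntegral.integrableOn_Ioo_rpow_iff one_pos).mpr (by linarith))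

/-- `𝟙_(0,1] · y^(-e)` is integrable for `e < 1`. [folklore] -/
theorem integrable_indicator_Ioc_rpow_neg {e : ℝ} (he : e < 1) :
    Integrable ((Ioc (0 : ℝ) 1).indicator fun y => y ^ (-e)) := by
  refine (integrable_indicator_iff measurableSet_Ioc).mpr ?_
  exact (integrableOn_Ioc_iff_integrableOn_Ioo (by simp)).mpr
    ((intervalIntegral.integrableOn_Ioo_rpow_iff one_pos).mpr (by linarith))

/-- The envelope of the padding coordinate: `𝟙_(0,1] + 𝟙_(1,∞) · u^(-γ)` is integrable for
`1 < γ`. [folklore] -/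
theorem integrable_paddingEnvelope {γ : ℝ} (hγ : 1 < γ) :
    Integrable (fun u : ℝ => (Ioc (0 : ℝ) 1).indicator (fun _ => (1 : ℝ)) u +
      (Ioi (1 : ℝ)).indicator (fun u => u ^ (-γ)) u) := by
  refine Integrable.add ?_ ?_
  · exact (integrable_indicator_iff measurableSet_Ioc).mpr
      (integrableOn_const (by simp [Real.volume_Ioc]))
  · exact (integrable_indicator_iff measurableSet_Ioi).mpr
      ((integrableOn_Ioi_rpow_iff one_pos).mpr (by linarith))

/-! ### Elementary inequalities on the padded domain -/

/-- On the padded domain, `u < s^(-p/q)`: from `0 < s`, `0 < q` and `u^q s^p < 1`.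
[folklore] -/
theorem lt_rpow_neg_div_of_pow_mul_pow_lt_one {s u : ℝ} (hs : 0 < s) {p q : ℕ}
    (hq : 0 < q) (h : u ^ q * s ^ p < 1) : u < s ^ (-(p : ℝ) / q) := by
  have hq0 : (q : ℝ) ≠ 0 := by exact_mod_cast hq.ne'
  have key : (s ^ (-(p : ℝ) / q)) ^ q * s ^ p = 1 := by
    rw [← Real.rpow_natCast (s ^ (-(p : ℝ) / q)) q, ← Real.rpow_mul hs.le,
      div_mul_cancel₀ _ hq0, Real.rpow_neg hs.le, Real.rpow_natCast,
      inv_mul_cancel₀ (pow_ne_zero _ hs.ne')]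
  by_contra hle
  push Not at hle
  have h1 : (s ^ (-(p : ℝ) / q)) ^ q ≤ u ^ q := pow_le_pow_left₀ (Real.rpow_nonneg hs.le _) hle q
  have h2 := mul_le_mul_of_nonneg_right h1 (pow_pos hs p).le
  rw [key] at h2
  linarith

/-- For `0 < s ≤ y` and `0 ≤ δ`: `y⁻¹ ≤ s^(-δ) · y^(-(1-δ))` when moreover `0 < y`. [folklore] -/
theorem inv_le_rpow_mul_rpow {s y δ : ℝ} (hs : 0 < s) (hsy : s ≤ y) (hδ : 0 ≤ δ) :
    y⁻¹ ≤ s ^ (-δ) * y ^ (-(1 - δ)) := by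
  have hy : 0 < y := hs.trans_le hsy
  have h1 : y⁻¹ = y ^ (-δ) * y ^ (-(1 - δ)) := by
    rw [← Real.rpow_add hy, ← Real.rpow_neg_one]
    congr 1
    ring
  rw [h1]
  exact mul_le_mul_of_nonneg_right (Real.rpow_le_rpow_of_nonpos hs hsy (by linarith))
    (Real.rpow_nonneg hy.le _)

/-! ### The elementary products exist -/

variable {d : ℕ}

/-- The domain of an elementary divergent product, in coordinates: `0 < z 0 < 1`, `0 < z 1`,
`(z 1)^q (z 0)^p < 1`, `z 0 ≤ y_j ≤ 1`, `w ∈ ρ.domain`, where `y_j = z (j+2)` (`j < b`) and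
`w_l = z (b+l+2)`; it is `ℚ`-semialgebraic. [Bochnak–Coste–Roy 1998, §2.1] [folklore] -/
theorem isSemialgebraic_elementaryDomain (p q b : ℕ) (ρ : IntegralRep d) :
    IsSemialgebraic ℚ {z : Fin (b + d + 1 + 1) → ℝ | 0 < z 0 ∧ z 0 < 1 ∧ 0 < z 1 ∧
      z 1 ^ q * z 0 ^ p < 1 ∧ (∀ j : Fin b, z 0 ≤ z (Fin.castAdd d j).succ.succ ∧
        z (Fin.castAdd d j).succ.succ ≤ 1) ∧
      (fun l : Fin d => z (Fin.natAdd b l).succ.succ) ∈ ρ.domain} := by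
  have h0 : IsSemialgebraic ℚ {z : Fin (b + d + 1 + 1) → ℝ | 0 < z 0} := by
    simpa using isSemialgebraic_setOf_eval_pos (k := ℚ) (R := ℝ) (X (0 : Fin (b + d + 1 + 1)))
  have h1 : IsSemialgebraic ℚ {z : Fin (b + d + 1 + 1) → ℝ | z 0 < 1} := by
    simpa using isSemialgebraic_setOf_eval_lt (k := ℚ) (R := ℝ) (X (0 : Fin (b + d + 1 + 1))) 1
  have h2 : IsSemialgebraic ℚ {z : Fin (b + d + 1 + 1) → ℝ | 0 < z 1} := by
    simpa using isSemialgebraic_setOf_eval_pos (k := ℚ) (R := ℝ) (X (1 : Fin (b + d + 1 + 1)))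
  have h3 : IsSemialgebraic ℚ {z : Fin (b + d + 1 + 1) → ℝ | z 1 ^ q * z 0 ^ p < 1} := by
    have := isSemialgebraic_setOf_eval_pos (k := ℚ) (R := ℝ)
      (1 - (X (1 : Fin (b + d + 1 + 1)) : MvPolynomial _ ℚ) ^ q * X 0 ^ p)
    convert this using 2 with z
    simp [sub_pos]
  have h4 : IsSemialgebraic ℚ {z : Fin (b + d + 1 + 1) → ℝ | ∀ j : Fin b,
      z 0 ≤ z (Fin.castAdd d j).succ.succ ∧ z (Fin.castAdd d j).succ.succ ≤ 1} := by
    have : ∀ j : Fin b, IsSemialgebraic ℚ {z : Fin (b + d + 1 + 1) → ℝ |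
        z 0 ≤ z (Fin.castAdd d j).succ.succ ∧ z (Fin.castAdd d j).succ.succ ≤ 1} := by
      intro j
      have ha : IsSemialgebraic ℚ {z : Fin (b + d + 1 + 1) → ℝ | z 0 ≤ z (Fin.castAdd d j).succ.succ} := by
        simpa using isSemialgebraic_setOf_eval_le (k := ℚ) (R := ℝ)
          (X (0 : Fin (b + d + 1 + 1))) (X (Fin.castAdd d j).succ.succ)
      have hb : IsSemialgebraic ℚ {z : Fin (b + d + 1 + 1) → ℝ | z (Fin.castAdd d j).succ.succ ≤ 1} := by
        simpa using isSemialgebraic_setOf_eval_le (k := ℚ) (R := ℝ)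
          (X (Fin.castAdd d j).succ.succ : MvPolynomial (Fin (b + d + 1 + 1)) ℚ) 1
      simpa [setOf_and] using ha.inter hb
    convert IsSemialgebraic.biInter Finset.univ _ (fun j _ => this j) using 1
    ext z
    simp
  have h5 : IsSemialgebraic ℚ {z : Fin (b + d + 1 + 1) → ℝ |
      (fun l : Fin d => z (Fin.natAdd b l).succ.succ) ∈ ρ.domain} :=
    ρ.isSemialgebraic_domain.preimage_comp (fun l : Fin d => (Fin.natAdd b l).succ.succ)
  convert ((((h0.inter h1).inter h2).inter h3).inter h4).inter h5 using 1
  ext z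
  simp only [mem_setOf_eq, mem_inter_iff]
  tauto

/-- Reassembling a point of `ℝᵇ⁺ᵈ⁺²` from its coordinates `(s, u, y, w)`. [folklore] -/
theorem vecCons_vecCons_append_eq {b : ℕ} (z : Fin (b + d + 1 + 1) → ℝ) :
    Matrix.vecCons (z 0) (Matrix.vecCons (z 1) (Fin.append
      (fun j : Fin b => z (Fin.castAdd d j).succ.succ) (fun l : Fin d => z (Fin.natAdd b l).succ.succ))) = z := by
  funext i
  refine Fin.cases ?_ (fun i' => Fin.cases ?_ (fun k => ?_) i') i
  · simp
  · simp
  · simp only [Matrix.cons_val_succ]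
    refine Fin.addCases (fun j => ?_) (fun l => ?_) k
    · simp
    · simp

/-- The item's `∃`-description of the elementary domain agrees with the coordinate description.
[folklore] -/
theorem elementaryDomain_eq (p q b : ℕ) (ρ : IntegralRep d) :
    {z : Fin (b + d + 1 + 1) → ℝ | ∃ (s u : ℝ) (y : Fin b → ℝ) (w : Fin d → ℝ),
      z = Matrix.vecCons s (Matrix.vecCons u (Fin.append y w)) ∧ 0 < s ∧ s < 1 ∧ 0 < u ∧
        u ^ q * s ^ p < 1 ∧ (∀ j, s ≤ y j ∧ y j ≤ 1) ∧ w ∈ ρ.domain} =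
    {z | 0 < z 0 ∧ z 0 < 1 ∧ 0 < z 1 ∧ z 1 ^ q * z 0 ^ p < 1 ∧
      (∀ j : Fin b, z 0 ≤ z (Fin.castAdd d j).succ.succ ∧ z (Fin.castAdd d j).succ.succ ≤ 1) ∧
      (fun l : Fin d => z (Fin.natAdd b l).succ.succ) ∈ ρ.domain} := by
  ext z
  simp only [mem_setOf_eq]
  constructor
  · rintro ⟨s, u, y, w, rfl, hs, hs1, hu, huq, hy, hw⟩
    refine ⟨by simpa using hs, by simpa using hs1, by simpa using hu, by simpa using huq,
      fun j => by simpa using hy j, by simpa using hw⟩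
  · rintro ⟨hs, hs1, hu, huq, hy, hw⟩
    exact ⟨z 0, z 1, _, _, (vecCons_vecCons_append_eq z).symm, hs, hs1, hu, huq, hy, hw⟩

/-! ### Semialgebraic bookkeeping -/

/-- A semialgebraic function read through a selection of coordinates is semialgebraic on the
corresponding cylinder: if `f` is `ℚ`-semialgebraic on `σ ⊆ ℝᵈ` and `θ : Fin d → Fin m`, then
`v ↦ f (v ∘ θ)` is `ℚ`-semialgebraic on `{v | v ∘ θ ∈ σ}` (a coordinate preimage of the graph).
[Bochnak–Coste–Roy 1998, §2.2] [folklore] -/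
theorem isSemialgebraicFunOn_comp_coords {m : ℕ} {σ : Set (Fin d → ℝ)} {f : (Fin d → ℝ) → ℝ}
    (hf : IsSemialgebraicFunOn ℚ σ f) (θ : Fin d → Fin m) :
    IsSemialgebraicFunOn ℚ {v : Fin m → ℝ | (fun l => v (θ l)) ∈ σ} (fun v => f (fun l => v (θ l))) := by
  rw [isSemialgebraicFunOn_iff]
  let ρ : Fin (d + 1) → Fin (m + 1) := Fin.lastCases (Fin.last m) fun i => Fin.castSucc (θ i)
  have hΓ := (isSemialgebraicFunOn_iff.mp hf).preimage_comp ρ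
  convert hΓ using 1
  have hinit : ∀ w : Fin (m + 1) → ℝ, Fin.init (w ∘ ρ) = fun l => Fin.init w (θ l) := by
    intro w; ext i; simp [Fin.init, ρ]
  have hlast : ∀ w : Fin (m + 1) → ℝ, (w ∘ ρ) (Fin.last d) = w (Fin.last m) := by
    intro w; simp [ρ]
  ext w
  simp only [mem_setOf_eq, mem_preimage, hinit, hlast]

/-- Finite products of `ℚ`-semialgebraic functions are `ℚ`-semialgebraic. [BCR 1998, Prop. 2.2.6]
[folklore] -/
theorem isSemialgebraicFunOn_finset_prod' {m : ℕ} {s : Set (Fin m → ℝ)} {ι : Type*}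
    (hs : IsSemialgebraic ℚ s) (t : Finset ι) (F : ι → (Fin m → ℝ) → ℝ)
    (hF : ∀ i ∈ t, IsSemialgebraicFunOn ℚ s (F i)) :
    IsSemialgebraicFunOn ℚ s (fun x => ∏ i ∈ t, F i x) := by
  classical
  induction t using Finset.induction_on with
  | empty => simpa using isSemialgebraicFunOn_natCast (k := ℚ) (R := ℝ) hs 1
  | @insert a t ha ih =>
    have h := IsSemialgebraicFunOn.mul_holds (hF a (Finset.mem_insert_self a t))
      (ih fun i hi => hF i (Finset.mem_insert_of_mem hi))
    exact h.congr fun x _ => by simp [Finset.prod_insert ha]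

/-- The integrand `∏ y_j⁻¹ · ρ.integrand w` of an elementary product is `ℚ`-semialgebraic on every
`ℚ`-semialgebraic set on which the `y_j` do not vanish and `w ∈ ρ.domain`. [BCR 1998, Prop. 2.2.6]
[folklore] -/
theorem isSemialgebraicFunOn_elementaryIntegrand {b : ℕ} (ρ : IntegralRep d)
    {D : Set (Fin (b + d + 1 + 1) → ℝ)} (hD : IsSemialgebraic ℚ D)
    (hy : ∀ z ∈ D, ∀ j : Fin b, z (Fin.castAdd d j).succ.succ ≠ 0)
    (hw : D ⊆ {z | (fun l : Fin d => z (Fin.natAdd b l).succ.succ) ∈ ρ.domain}) :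
    IsSemialgebraicFunOn ℚ D (fun z => (∏ j : Fin b, (z (Fin.castAdd d j).succ.succ)⁻¹) *
      ρ.integrand (fun l : Fin d => z (Fin.natAdd b l).succ.succ)) := by
  refine IsSemialgebraicFunOn.mul_holds ?_ ?_
  · exact isSemialgebraicFunOn_finset_prod' hD Finset.univ _ fun j _ =>
      (isSemialgebraicFunOn_apply hD _).inv fun z hz => hy z hz j
  · exact (isSemialgebraicFunOn_comp_coords ρ.isSemialgebraicFunOn_integrand
      (fun l : Fin d => (Fin.natAdd b l).succ.succ)).mono hw hD

end Summit.KontsevichZagierPeriods.ValuedFieldSpecialisation
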